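import Summits.SmoothPoincare4.SmoothPoincare4.Theorems.DottedCircleRasmussenDcrGapHelperHandlebodyChartModelHandlesPlanarTube
import Summits.SmoothPoincare4.SmoothPoincare4.Theorems.DottedCircleRasmussenDcrGapHelperHandlebodyChartModelHandlesPolar

/-!
# Helper `helper_handlebodyChart_modelHandles` (M3: handle structure of the model dotted handlebody `D_k`)
# of line `mk_friends` for crux `DcrGap` — handle charts, part 5: calculus of the planar components in `ℝ⁴`
(item stmt-SmoothPoincare4-16128, route route-SmoothPoincare4-DottedCircleRasmussen)

Towards the registered stub `helper_handlebodyChart_modelHandles_data_part1`.  The planar tube map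
`(R(p₀) + b(p₁) sin(π S(p₀)), -b(p₁) cos(π S(p₀)))` of `…ModelHandlesPlanarTube.lean` is here regarded as a
pair of real functions on `ℝ⁴` (through the coordinates `p₀`, `p₁`), as the polar chart of
`…ModelHandlesPolar.lean` requires:

* `ModelHandles.fderiv_comp_coord`: `D(f ∘ pᵢ)(p) v = f'(pᵢ) vᵢ`;
* `ModelHandles.planar_fderiv`: the derivatives of the two components along `v` are
  `(R' + b π S' cos θ) v₀ + b' sin θ v₁` and `b π S' sin θ v₀ - b' cos θ v₁` (`θ = π S(p₀)`);
* `ModelHandles.planar_kernel`: hence their common kernel is `v₀ = v₁ = 0` wherever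
  `R' cos θ + b π S' > 0` (`ModelHandles.tube_kernel_trivial`);
* `ModelHandles.planar_contDiff`: both components are smooth on `ℝ⁴`;
* `ModelHandles.map_nhds_eq_of_injective_fderiv`: a `C¹` self-map of `ℝ⁴` with injective derivative at `p`
  is open at `p` (inverse function theorem), the tool for the cover of the arches.

Registered summary `helper_handlebodyChart_modelHandles_chartCalculus`.  No definitions, no named facts,
no `sorry`.  References: R. Kirby, *The Topology of 4-Manifolds*, LNM 1374 (1989), Ch. I §2 [Kirby1989].
-/

-- the prescribed namespace `Summit.<P>.<Sub>.…` duplicates `SmoothPoincare4` (P = Sub)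
set_option linter.dupNamespace false
set_option linter.style.longLine false
noncomputable section

open scoped ContDiff Topology
open Function Set Filter Real

namespace Summit.SmoothPoincare4.SmoothPoincare4.Theorems.DcrGap.MkFriends

namespace ModelHandles

/-! ## Derivatives through a coordinate -/

/-- **Chain rule through a coordinate**: if `f` has derivative `f'` at `pᵢ` then `p ↦ f(pᵢ)` has derivative
`v ↦ f' vᵢ` at `p`. [folklore] -/
theorem hasFDerivAt_comp_coord {f : ℝ → ℝ} {f' : ℝ} (i : Fin 4) {p : EuclideanSpace ℝ (Fin 4)}
    (hf : HasDerivAt f f' (p i)) :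
    HasFDerivAt (fun x : EuclideanSpace ℝ (Fin 4) => f (x i)) (f' • (EuclideanSpace.proj (𝕜 := ℝ) i)) p := by
  have hc : HasFDerivAt (fun x : EuclideanSpace ℝ (Fin 4) => x i) (EuclideanSpace.proj (𝕜 := ℝ) i) p := by
    have : (fun x : EuclideanSpace ℝ (Fin 4) => x i) = EuclideanSpace.proj (𝕜 := ℝ) i := by funext x; simp
    rw [this]; exact (EuclideanSpace.proj (𝕜 := ℝ) i).hasFDerivAt
  have h := hf.hasFDerivAt.comp p hc
  refine h.congr_fderiv ?_
  ext v
  simp [mul_comm]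

/-- **The derivatives of the planar components**: with `θ = π S(p₀)`, along `v`,
`D(R(p₀) + b(p₁) sin θ) v = (R' + b π S' cos θ) v₀ + b' sin θ v₁` and
`D(-b(p₁) cos θ) v = b π S' sin θ v₀ - b' cos θ v₁`. [folklore] -/
theorem planar_fderiv {R S b : ℝ → ℝ} {R' S' b' : ℝ} {p : EuclideanSpace ℝ (Fin 4)}
    (hR : HasDerivAt R R' (p 0)) (hS : HasDerivAt S S' (p 0)) (hb : HasDerivAt b b' (p 1)) (v : EuclideanSpace ℝ (Fin 4)) :
    fderiv ℝ (fun x : EuclideanSpace ℝ (Fin 4) => R (x 0) + b (x 1) * sin (π * S (x 0))) p v =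
      (R' + b (p 1) * π * S' * cos (π * S (p 0))) * v 0 + b' * sin (π * S (p 0)) * v 1 ∧
    fderiv ℝ (fun x : EuclideanSpace ℝ (Fin 4) => -b (x 1) * cos (π * S (x 0))) p v =
      b (p 1) * π * S' * sin (π * S (p 0)) * v 0 - b' * cos (π * S (p 0)) * v 1 := by
  have hR4 := hasFDerivAt_comp_coord 0 hR
  have hb4 := hasFDerivAt_comp_coord 1 hb
  -- `x ↦ sin(π S(x₀))`, `x ↦ cos(π S(x₀))`
  have hθ : HasDerivAt (fun t => π * S t) (π * S') (p 0) := hS.const_mul π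
  have hsin : HasDerivAt (fun t => sin (π * S t)) (cos (π * S (p 0)) * (π * S')) (p 0) := hθ.sin
  have hcos : HasDerivAt (fun t => cos (π * S t)) (-sin (π * S (p 0)) * (π * S')) (p 0) := hθ.cos
  have hsin4 := hasFDerivAt_comp_coord 0 hsin
  have hcos4 := hasFDerivAt_comp_coord 0 hcos
  constructor
  · have h : HasFDerivAt (fun x : EuclideanSpace ℝ (Fin 4) => R (x 0) + b (x 1) * sin (π * S (x 0))) _ p :=
      hR4.add (hb4.mul hsin4)
    rw [h.fderiv]
    simp only [add_apply, smul_apply, smul_eq_mul]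
    simp
    ring
  · have h : HasFDerivAt (fun x : EuclideanSpace ℝ (Fin 4) => -b (x 1) * cos (π * S (x 0))) _ p :=
      (hb4.neg).mul hcos4
    rw [h.fderiv]
    simp only [add_apply, smul_apply, smul_eq_mul, neg_apply]
    simp
    ring

/-- **The planar components have a common trivial kernel** wherever `R' cos θ + b π S' > 0` and `b' ≠ 0`.
[folklore] -/
theorem planar_kernel {R S b : ℝ → ℝ} {R' S' b' : ℝ} {p : EuclideanSpace ℝ (Fin 4)}
    (hR : HasDerivAt R R' (p 0)) (hS : HasDerivAt S S' (p 0)) (hb : HasDerivAt b b' (p 1))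
    (hD : 0 < R' * cos (π * S (p 0)) + b (p 1) * π * S') (hb' : b' ≠ 0) (v : EuclideanSpace ℝ (Fin 4))
    (h1 : fderiv ℝ (fun x : EuclideanSpace ℝ (Fin 4) => R (x 0) + b (x 1) * sin (π * S (x 0))) p v = 0)
    (h2 : fderiv ℝ (fun x : EuclideanSpace ℝ (Fin 4) => -b (x 1) * cos (π * S (x 0))) p v = 0) :
    v 0 = 0 ∧ v 1 = 0 := by
  obtain ⟨e1, e2⟩ := planar_fderiv hR hS hb v
  rw [e1] at h1
  rw [e2] at h2
  exact tube_kernel_trivial hD hb' h1 h2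

/-- **The planar components are smooth on `ℝ⁴`** when `R`, `S`, `b` are. [folklore] -/
theorem planar_contDiff {R S b : ℝ → ℝ} (hR : ContDiff ℝ ∞ R) (hS : ContDiff ℝ ∞ S) (hb : ContDiff ℝ ∞ b) :
    ContDiff ℝ ∞ (fun x : EuclideanSpace ℝ (Fin 4) => R (x 0) + b (x 1) * sin (π * S (x 0))) ∧
    ContDiff ℝ ∞ (fun x : EuclideanSpace ℝ (Fin 4) => -b (x 1) * cos (π * S (x 0))) := by
  have h0 : ContDiff ℝ ∞ (fun x : EuclideanSpace ℝ (Fin 4) => x 0) := by fun_prop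
  have h1 : ContDiff ℝ ∞ (fun x : EuclideanSpace ℝ (Fin 4) => x 1) := by fun_prop
  have hR4 := hR.comp h0
  have hS4 := hS.comp h0
  have hb4 := hb.comp h1
  have hθ : ContDiff ℝ ∞ (fun x : EuclideanSpace ℝ (Fin 4) => π * S (x 0)) := contDiff_const.mul hS4
  exact ⟨hR4.add (hb4.mul hθ.sin), hb4.neg.mul hθ.cos⟩

/-! ## Openness from an injective derivative -/

/-- **A `C¹` self-map of `ℝ⁴` with injective derivative at `p` is open at `p`**: `map f (𝓝 p) = 𝓝 (f p)`
(an injective endomorphism of `ℝ⁴` is surjective; inverse function theorem). [folklore] -/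
theorem map_nhds_eq_of_injective_fderiv {f : EuclideanSpace ℝ (Fin 4) → EuclideanSpace ℝ (Fin 4)}
    {p : EuclideanSpace ℝ (Fin 4)} {n : WithTop ℕ∞} (hf : ContDiffAt ℝ n f p) (hn : n ≠ 0)
    (hinj : Injective (fderiv ℝ f p)) : map f (𝓝 p) = 𝓝 (f p) := by
  have hstrict := hf.hasStrictFDerivAt hn
  refine hstrict.map_nhds_eq_of_surj ?_
  have hsurj : Surjective (fderiv ℝ f p) := by
    have h := LinearMap.injective_iff_surjective (f := ((fderiv ℝ f p : EuclideanSpace ℝ (Fin 4) →L[ℝ] EuclideanSpace ℝ (Fin 4)) :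
      EuclideanSpace ℝ (Fin 4) →ₗ[ℝ] EuclideanSpace ℝ (Fin 4)))
    exact h.1 hinj
  exact LinearMap.range_eq_top.2 hsurj

/-- **Images of neighbourhoods are neighbourhoods** for such a map. [folklore] -/
theorem image_mem_nhds_of_injective_fderiv {f : EuclideanSpace ℝ (Fin 4) → EuclideanSpace ℝ (Fin 4)}
    {p : EuclideanSpace ℝ (Fin 4)} {n : WithTop ℕ∞} (hf : ContDiffAt ℝ n f p) (hn : n ≠ 0)
    (hinj : Injective (fderiv ℝ f p)) {s : Set (EuclideanSpace ℝ (Fin 4))} (hs : s ∈ 𝓝 p) :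
    f '' s ∈ 𝓝 (f p) := by
  rw [← map_nhds_eq_of_injective_fderiv hf hn hinj]
  exact image_mem_map hs

end ModelHandles

/-- **Registered piece `helper_handlebodyChart_modelHandles_chartCalculus` of the data stub, part 1 (calculus of
the planar components in `ℝ⁴`)**: the derivatives along `v` of `p ↦ R(p₀) + b(p₁) sin(π S(p₀))` and
`p ↦ -b(p₁) cos(π S(p₀))` have common kernel `v₀ = v₁ = 0` wherever `R' cos(π S) + b π S' > 0`, `b' ≠ 0`
(`ModelHandles.planar_kernel`), and a `C¹` self-map of `ℝ⁴` with injective derivative at `p` is open at `p`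
(`ModelHandles.map_nhds_eq_of_injective_fderiv`). [folklore] -/
theorem helper_handlebodyChart_modelHandles_chartCalculus : (∀ (R S b : ℝ → ℝ) (R' S' b' : ℝ) (p : EuclideanSpace ℝ (Fin 4)), HasDerivAt R R' (p 0) → HasDerivAt S S' (p 0) → HasDerivAt b b' (p 1) → 0 < R' * Real.cos (Real.pi * S (p 0)) + b (p 1) * Real.pi * S' → b' ≠ 0 → ∀ v : EuclideanSpace ℝ (Fin 4), fderiv ℝ (fun x : EuclideanSpace ℝ (Fin 4) => R (x 0) + b (x 1) * Real.sin (Real.pi * S (x 0))) p v = 0 → fderiv ℝ (fun x : EuclideanSpace ℝ (Fin 4) => -b (x 1) * Real.cos (Real.pi * S (x 0))) p v = 0 → v 0 = 0 ∧ v 1 = 0) ∧ (∀ (f : EuclideanSpace ℝ (Fin 4) → EuclideanSpace ℝ (Fin 4)) (p : EuclideanSpace ℝ (Fin 4)), ContDiffAt ℝ ((⊤ : ℕ∞) : WithTop ℕ∞) f p → Function.Injective (fderiv ℝ f p) → Filter.map f (nhds p) = nhds (f p)) :=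
  ⟨fun _ _ _ _ _ _ _ hR hS hb hD hb' v h1 h2 => ModelHandles.planar_kernel hR hS hb hD hb' v h1 h2,
   fun _ _ hf hinj => ModelHandles.map_nhds_eq_of_injective_fderiv hf (by simp) hinj⟩

end Summit.SmoothPoincare4.SmoothPoincare4.Theorems.DcrGap.MkFriends

end
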